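import Summits.BirchSwinnertonDyer.Rank1Residual.AdditivePotMult.ClassTheorems
import Summits.BirchSwinnertonDyer.Rank1Residual.X2.RankZero
import HarnessLib

/-!
# X3♯(M) with a Greenberg–Vatsal twist: `BSD(E,p) ⇐ MissingPPartOverAt(E_K,p)` ALONE

HONEST FRAMING (cell `b2b-bsdres`, run/shared/lean/b2b/bsd-rank1-residual/, verbatim in every
file): the goal of the cell is to DELETE the COMBINATION-SHAPED residual classes of the
Birch–Swinnerton-Dyer formula for ALL analytic-rank `≤ 1` elliptic curves over `ℚ` — "full BSD
formula for every rank `≤ 1` curve in class `C`" assembled STRICTLY from published theorems — so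
that the rank-`≤ 1` remainder becomes exactly the CONSTRUCTION-SHAPED classes, which are TYPED
(missing-input `Prop`s), NOT attempted. This is not "finishing BSD". Sub-cell
`b2b-bsdres-additive-p1` (CLASS-OWNERS row "X3/X4 additive — pot. multiplicative / X3♯(M)"),
generation 2; a RESEARCH ROUTE, no claim beyond the stated sub-classes; X3♯(M) REMAINS
CONSTRUCTION-SHAPED (no label moves).

Theorems only; no definition, no named fact. This file is the X3♯(M) analogue of
`bsdp_of_classX4M_of_rankZero_twist` (`ClassTheorems.lean`): there, for X4(M), the
`p`-multiplicative twist `E^{(D)}` is COVERED by Skinner 2016 Thm. C when `L(E^{(D)},1) ≠ 0` and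
(ram), so the whole missing input is the typed over-`K` statement. Here, for X3♯(M) (`E[p]`
reducible), the twist `E^{(D)}` is an X2 pair (`classX2_twist_of_classX3M`: `p` odd, multiplicative,
reducible), and the X2 owner of the cell (unit `b2b-bsdres-eisenstein-p2`,
`Summits/BirchSwinnertonDyer/Rank1Residual/X2/RankZero.lean`) has CLOSED the sub-cell
**X2a = X2 ∧ `r_an = 0` ∧ gvpar** from published named facts
(`X2.bsdp_of_classX2_of_gvPar_of_analyticRank_eq_zero`: Greenberg–Vatsal 2000 at a multiplicative
prime `hGV` [cell flag `GV00-mult-asserted`, referee to rule], Wuthrich 2014 Thm. 16 `hWu`,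
Stein–Wuthrich 2013 Thm. 6.1 `hJs`/`hJn` and §4.2 `hHs`/`hHn`, Greenberg–Stevens `hGS`,
Gross–Zagier–Kolyvagin `hGZK`, modularity `hmod`/`hpar`). Composing with the descent theorem
(`bsdp_of_pPartOver_of_bsdp_twist'`, Milne 1972 `hMilne`):

* `bsdp_twist_of_rankZero_gvPar` — the twist side `BSD(E^{(D)},p)` for a globally minimal model
  `Wd` of the twist that is multiplicative at the odd prime `p`, with `E^{(D)}[p]` reducible,
  `L(E^{(D)},1) ≠ 0` and `GVPar Wd p` (SOME rational `p`-isogeny kernel ramified-at-`p`-and-even or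
  unramified-at-`p`-and-odd; at a multiplicative prime the two kernel characters are `ψ` and
  `ψ⁻¹ω` with exactly one unramified at `p`, so gvpar reads "the unramified one is odd").
* `bsdp_of_classX3M_of_gvPar_rankZero_twist` — **X3♯(M)ᴳⱽ := X3♯(M) ∧ [the `p`-multiplicative
  twist `E^{(d_K)}` has `L = ≠ 0` at `1` and gvpar]: `BSD(E,p) ⇐ MissingPPartOverAt(E_K,p)` ALONE** —
  the typed over-`K` input of `Descent.lean` (the `p`-part of BSD for `E_K` over the quadratic
  field `K`, `p` ramified, `E_K` multiplicative at the prime above `p`), every other input being a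
  published theorem taken as a named-fact binder. This upgrades the gen-0 statement
  `bsdp_of_classX3M_of_rankZero_twist` (over-`K` input + `MissingLowerBoundAt` of the twist) on the
  gvpar rows: the lower bound of the twist is no longer missing there.
* `missingPPartAt_of_classX3M_of_gvPar_rankZero_twist` — the same in the cell's `MissingPPartAt`
  currency (for the Partition / additive-p4's `X3SharpM` bookkeeping).

Which D. For an X3♯(M) pair every `D ∈ p*·m` (`m` a `p`-adic unit) makes `E^{(D)}` multiplicative
at `p` (`PotMult.exists_twist_mult` and the square-class remark of `ClassTheorems.lean`); replacing
`m` by `-m` multiplies both kernel characters by the odd character `χ_{-1}·(unit at p)`, i.e. FLIPS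
gvpar, and also changes the root number of `E^{(D)}`; whether some admissible `D` has BOTH
`w(E^{(D)}) = +1, L(E^{(D)},1) ≠ 0` AND gvpar is a per-pair census bit (HOME report §5, PARI twist
scan), NOT asserted here. The located gap is unchanged (module docstring of `ClassTheorems.lean`:
no published theorem reaches the over-`K` input because `p` ramifies in `K`; gen-2 literature
addendum in HOME/b2b-bsdres-additive-p1/REPORT.md §4: Burungale–Skinner–Tian–Wan arXiv:2409.01350
Thm. 1.21(c) announces the Eisenstein-congruence divisibility for `g ⊗ χ_K`, `p ∣ d_K`, only for
`p ∤ 6N_g` — the potentially GOOD ordinary twist —, not for `p ‖ N_g`).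
-/

noncomputable section

open scoped Classical

open WeierstrassCurve Literature.NumberTheory.EllipticCurves
  Literature.NumberTheory.EllipticCurves.ModularForms
  Literature.NumberTheory.EllipticCurves.Rank1Residual
  Literature.NumberTheory.EllipticCurves.Rank1Residual.Typed
  Literature.NumberTheory.EllipticCurves.GreenbergVatsal2000
  Literature.NumberTheory.EllipticCurves.Wuthrich2014
  Literature.NumberTheory.EllipticCurves.SteinWuthrich2013

namespace Summit.BirchSwinnertonDyer.Rank1Residual.AdditivePotMult

variable (W : WeierstrassCurve ℚ) [W.IsElliptic] [W.IsGloballyMinimal] (p : ℕ) [Fact p.Prime]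
  (K : Type) [Field K] [NumberField K]
  (Wd : WeierstrassCurve ℚ) [Wd.IsElliptic] [Wd.IsGloballyMinimal]
  (W' : WeierstrassCurve K) [W'.IsElliptic] [W'.IsGloballyMinimal]

omit [W.IsElliptic] [W.IsGloballyMinimal] in
/-- **The twist side on sub-cell X2a** (the X2 owner's closed sub-cell, here merely invoked): for a
globally minimal `Wd` of analytic rank `0`, multiplicative at the odd prime `p`, with `Wd[p]`
reducible and the Greenberg–Vatsal parity condition `GVPar Wd p`, `BSD(Wd, p)` holds granted the
published named facts Greenberg–Vatsal 2000 (multiplicative prime; `hGV`), Wuthrich 2014 Thm. 16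
(`hWu`), Stein–Wuthrich 2013 Thm. 6.1 (`hJs`, `hJn`) and §4.2 (`hHs`, `hHn`), Greenberg–Stevens
(`hGS`), Gross–Zagier–Kolyvagin (`hGZK`) and modularity (`hmod`, `hpar`) — this is
`X2.bsdp_of_classX2_of_gvPar_of_analyticRank_eq_zero` on the X2 pair `(Wd, p)`.
[cite: GreenbergVatsal2000, Thm. (1.3) with pp. 1, 14–15] [cite: Wuthrich2014, Thm. 16 (p. 397)]
[cite: SteinWuthrich2013, Thm. 6.1 (p. 20) and §4.2] -/
theorem bsdp_twist_of_rankZero_gvPar (hGV : lambdaMu_multiplicative_of_gvPar)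
    (hWu : thm16_charIdeal_dvd_multiplicative_of_reducible)
    (hJs : thm61_splitMultiplicative) (hJn : thm61_nonsplitMultiplicative)
    (hHs : exists_isSplitMultCanonical) (hHn : exists_isMultCanonical)
    (hGZK : rank_eq_analyticRank_of_analyticRank_le_one) (hmod : hasEntireLFunction_rat)
    (hpar : nonempty_modularParametrizationData)
    (hGS : greenberg_stevens (W := Wd) (p := p))
    (hp : p ≠ 2) (hmult : Mult Wd p) (hred : Red Wd p) (hgv : GVPar Wd p)
    (hr0 : Wd.analyticRank = 0) : BSDp Wd p :=
  X2.bsdp_of_classX2_of_gvPar_of_analyticRank_eq_zero hGV hWu hJs hJn hHs hHn hGZK hmod hpar Wd p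
    hGS hr0 ⟨hp, hred, hmult⟩ hgv

/-- **X3♯(M) with a rank-zero Greenberg–Vatsal twist: `BSD(E,p) ⇐ MissingPPartOverAt(E_K,p)`
ALONE.** For `(E,p) ∈ X3♯(M)` (odd additive Eisenstein `p`, `ord_p j < 0`) of analytic rank `≤ 1`,
a quadratic field `K` whose twist `Wd ≅ E^{(d_K)}` is MULTIPLICATIVE at `p`, has `L(E^{(d_K)},1) ≠ 0`
(`analyticRank = 0`) and satisfies gvpar (`GVPar Wd p`), and a globally minimal `K`-model `W'` of
`E_K`: the twist is an X2 pair (`classX2_twist_of_classX3M`) in the X2 owner's CLOSED sub-cell X2a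
(`bsdp_twist_of_rankZero_gvPar`), so the descent theorem with Milne's identity discharged
(`bsdp_of_pPartOver_of_bsdp_twist'`) leaves EXACTLY the typed over-`K` input. All other inputs are
published theorems carried as named-fact binders (Greenberg–Vatsal 2000 [flag `GV00-mult-asserted`],
Wuthrich 2014 Thm. 16, Stein–Wuthrich 2013, Greenberg–Stevens, Milne 1972, GZK, modularity).
Nothing asserts that such `K` exists for a given pair (census bit). X3♯(M) stays
CONSTRUCTION-SHAPED: the over-`K` input is printed nowhere (p ramified in `K`). [folklore] -/
theorem bsdp_of_classX3M_of_gvPar_rankZero_twist (hGV : lambdaMu_multiplicative_of_gvPar)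
    (hWu : thm16_charIdeal_dvd_multiplicative_of_reducible)
    (hJs : thm61_splitMultiplicative) (hJn : thm61_nonsplitMultiplicative)
    (hHs : exists_isSplitMultCanonical) (hHn : exists_isMultCanonical)
    (hGZK : rank_eq_analyticRank_of_analyticRank_le_one) (hmod : hasEntireLFunction_rat)
    (hpar : nonempty_modularParametrizationData)
    (hMilne : Milne1972.bsdQuotient_baseChange_quadratic)
    (hGS : greenberg_stevens (W := Wd) (p := p))
    (hX : ClassX3M W p) (hr : W.analyticRank ≤ 1) (h2 : Module.finrank ℚ K = 2)
    (hWd : ∃ C : VariableChange ℚ, C • W.quadraticTwist (NumberField.discr K : ℚ) = Wd)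
    (hmult : Mult Wd p) (hgv : GVPar Wd p) (hr0 : Wd.analyticRank = 0)
    (hW' : ∃ C : VariableChange K, C • W.baseChange K = W')
    (hK : MissingPPartOverAt W' p) : BSDp W p := by
  have hD : (NumberField.discr K : ℚ) ≠ 0 := by exact_mod_cast NumberField.discr_ne_zero K
  obtain ⟨hp2, hred, -⟩ := classX2_twist_of_classX3M hX hD hWd hmult
  have hd : BSDp Wd p :=
    bsdp_twist_of_rankZero_gvPar p Wd hGV hWu hJs hJn hHs hHn hGZK hmod hpar hGS hp2 hmult hred hgv hr0
  exact bsdp_of_pPartOver_of_bsdp_twist' W p K Wd W' hGZK hmod hMilne hr h2 hWd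
    (by rw [hr0]; exact zero_le_one) hW' hK hd

/-- The same conversion in the cell's `MissingPPartAt` currency (Partition / additive-p4's
`X3SharpM` bookkeeping): on an X3♯(M) pair with a rank-zero gvpar twist datum, the over-`K` input
yields `MissingPPartAt W p`. [folklore] -/
theorem missingPPartAt_of_classX3M_of_gvPar_rankZero_twist (hGV : lambdaMu_multiplicative_of_gvPar)
    (hWu : thm16_charIdeal_dvd_multiplicative_of_reducible)
    (hJs : thm61_splitMultiplicative) (hJn : thm61_nonsplitMultiplicative)
    (hHs : exists_isSplitMultCanonical) (hHn : exists_isMultCanonical)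
    (hGZK : rank_eq_analyticRank_of_analyticRank_le_one) (hmod : hasEntireLFunction_rat)
    (hpar : nonempty_modularParametrizationData)
    (hMilne : Milne1972.bsdQuotient_baseChange_quadratic)
    (hGS : greenberg_stevens (W := Wd) (p := p))
    (hX : ClassX3M W p) (hr : W.analyticRank ≤ 1) (h2 : Module.finrank ℚ K = 2)
    (hWd : ∃ C : VariableChange ℚ, C • W.quadraticTwist (NumberField.discr K : ℚ) = Wd)
    (hmult : Mult Wd p) (hgv : GVPar Wd p) (hr0 : Wd.analyticRank = 0)
    (hW' : ∃ C : VariableChange K, C • W.baseChange K = W')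
    (hK : MissingPPartOverAt W' p) : MissingPPartAt W p := by
  have hfin : Finite W.sha := (hGZK W hr).2
  haveI := hfin
  exact missingPPartAt_of_bsdp W p
    (bsdp_of_classX3M_of_gvPar_rankZero_twist W p K Wd W' hGV hWu hJs hJn hHs hHn hGZK hmod hpar
      hMilne hGS hX hr h2 hWd hmult hgv hr0 hW' hK)

end Summit.BirchSwinnertonDyer.Rank1Residual.AdditivePotMult

end
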